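import Summits.QuantumFields.BalabanUV.Beta.RemainderExplicitHistoryDiagonalEchoMonotone
import Mathlib.Algebra.Order.Chebyshev

/-!
# RemainderExplicitHistoryDiagonalRunEnvelope — ROAD P3, ORDER-0 PROFILE FAMILY: THE ENVELOPE OF ONE BOX RUN — ultraviolet suppression WITH THE
# PIN KEPT (`b(K − i)(g_i)³ ≤ g_K∕2`), increments priced by cubes (`g_{t+1} − g_t ≤ ((b + Wγ)∕2)(g_{t+1})³`), the SPREAD of the couplings ahead
# of a position (`Σ_{l∈[j,K)} (g_l − g_j) ≤ (1 + Wγ∕b)(K − j)g_K∕4`, double counting), the first increments against the cube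
# (`(g_j)³∕2 ≤ (g_j − g_0)(1∕(jb) + (g_j)²)`), CHEBYSHEV'S SUM INEQUALITY for a non-increasing profile against the increasing spread
# (`K·Σ_{l∈[j,K)} ρ(l+1)(g_l − g_j) ≤ W·Σ_{l∈[j,K)} (g_l − g_j)`), and the lower bound `Θ_j ≥ 13∕24 + (K − j)κ′_j` of the forward step's denominator
# under `4Wγ ≤ b` (station S-d4p3-g55-1 «one forward induction», first file: the closed-form toolkit for the second and third files)

Cell `pub-balaban`, β-function sub-cell, BINDER row D4 «RemainderConst leaves for Bałaban's split» (`HOME/BINDER-OWNERS.md`; owner lineage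
`b2b-balaban-beta-an4`; this file by co-owner #3 lineage `b2b-balaban-beta-d4-p3`, road P3 «the reduction road», generation 55, station
S-d4p3-g55-1, first file; imports generation 54's `RemainderExplicitHistoryDiagonalEchoMonotone` (hence generation 49's `…Window`, `…TwoRun`,
`…Weights`, `…Monotone`) and `Mathlib.Algebra.Order.Chebyshev`), β-FLOW TEAM duty (1); FREEZE (0) honoured (def-free module in road P3's own
`RemainderExplicit*` series; no leaf, no interface, no Literature file).  SOURCE OF THE SHAPES ONLY: [Balaban1987RG1] (0.20) p. 256, (0.31) and
Thm 2 p. 259, §5 p. 298.  [folklore] real analysis about ONE explicit toy family (ours), road P3's ORDER-0 PROFILE FAMILY (generation 44):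
`β_{k+1} = b + Σ_{a≤k} ρ(a)·min(g_k, |g_k − g_{k−a}|)`.
HONEST FRAMING: *"Discharging BetaPertH makes Bałaban's UV stability UNCONDITIONAL — a real constructive-QFT result; it is NOT the continuum
limit and NOT the Clay problem."*  THIS FILE DISCHARGES NOTHING OF THE KIND; nothing of Bałaban's (1.22) is asserted or constructed; row D4
class UNCHANGED (critical-path width 0; instance 0∕1; D4 DISCHARGE NO DATE); NOT B12 Thm 2, NOT BetaPertH, NOT continuum, NOT Clay.  HONEST
DEPENDENCY: continuum YM on T⁴ ⇐ BetaPertH ∧ nine spine estimates (0/9 proved); BetaPertH ⇐ (D1) ∧ (D4) ∧ CAP+tail; G-an2-4 gates asym, D1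
and NE2/3/4.  ABSOLUTE RULE: nothing is cited as a fact.  All letters NOT-IN-PRINT; `BetaFlowAsPrinted S` records a Markov β_n only.

WHY (census item (i′) of generations 50–54, «the matched discrepancy of two pinned runs is non-increasing in the position for every non-increasing
profile»).  The station's forward step (second file) reduces (i′) at each position to two scalar inequalities between run quantities; every
quantity in them is a sum of profile weights against couplings of ONE box run, so they are priced here by the run's envelope: the floor `b ≤ β`
(`1∕g_K² + b(K − i) ≤ 1∕g_i²`, the pin KEPT, so that `b(K−i)(g_i)³ ≤ g_i − (g_i)³∕g_K² ≤ g_K∕2` covers the running and the non-running regime at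
once), the ceiling `β ≤ b + Wγ`, the asymptotic-freedom budget `Σ_{i<K} (g_i)³ ≤ 2γ∕b`, and the two profile facts — monotonicity (Chebyshev) and
total mass `≤ W`.

WHAT IS PROVED ([folklore]; 0 sorry; 0 `def`).  §1 `dist_mul_cube_le_half`, `dist_mul_sq_le_one`, `beta_run_le`, `incr_le`, `gap_le_sum_cube`,
`spread_le_sum`, **`spread_le`**, **`cube_le_incr_mul`**, **`mul_sum_profile_spread_le`** (Chebyshev), `sum_shift_weights_le`
(`Σ_{i<j} ρ(j−i) + ρ(j+1) ≤ W`).  §2 `kappa_nonneg`, **`theta_lower`** (`13∕24 + (K − j)κ₂∕2 ≤ 1 − (K − j)σ₂∕2 − Λ₂∕(2(1 − Wγ∕b))` under `4Wγ ≤ b`;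
`σ₂`, `κ₂`, `Λ₂` as in the second file).
-/

noncomputable section

open Finset Filter Topology

namespace Summit.QuantumFields.BalabanUV.Beta.RemainderExplicitHistoryDiagonalRunEnvelope

open Literature.MathematicalPhysics.QuantumFieldTheory.Balaban1983to89
open Literature.MathematicalPhysics.QuantumFieldTheory.Balaban1983to89.FlowStep
open Literature.MathematicalPhysics.QuantumFieldTheory.Balaban1983to89.T4CouplingMatching
open Literature.MathematicalPhysics.QuantumFieldTheory.Balaban1983to89.T4ContinuumCoupling
open Summit.QuantumFields.BalabanUV.Beta.RemainderExplicitHistoryDiagonalMonotone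
open Summit.QuantumFields.BalabanUV.Beta.RemainderExplicitHistoryDiagonalWeights
open Summit.QuantumFields.BalabanUV.Beta.RemainderExplicitHistoryDiagonalTwoRun
open Summit.QuantumFields.BalabanUV.Beta.RemainderExplicitHistoryDiagonalWindow
open Summit.QuantumFields.BalabanUV.Beta.RemainderExplicitHistoryDiagonalOneStepMonotone
open Summit.QuantumFields.BalabanUV.Beta.RemainderExplicitHistoryDiagonalEchoMonotone

variable {β : HBeta} {b γ W : ℝ} {ρ : ℕ → ℝ}

/-! ## §1 One box run: the ultraviolet suppression with the pin kept, increments, the spread of the couplings ahead of a position -/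

/-- ULTRAVIOLET SUPPRESSION WITH THE PIN KEPT: on a box run of the family, `b·(K − i)·(g_i)³ ≤ g_K∕2` for every `i ≤ K` — the floor `b ≤ β` gives
`1∕g_K² + b(K − i) ≤ 1∕g_i²`, so `b(K−i)g_i³ ≤ g_i − g_i³∕g_K²`, and `u − u³ ≤ ½` on `[0,1]` (`u = g_i∕g_K`). [cite: Balaban1987RG1, (0.31) p.259] -/
theorem dist_mul_cube_le_half
    (hβ : ∀ (k : ℕ) (p : Fin (k + 1) → ℝ),
      β k p = b + ∑ i : Fin (k + 1), ρ (k - i) * min (p (Fin.last k)) (|p (Fin.last k) - p i|))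
    (hρ0 : ∀ a, 0 ≤ ρ a) {K : ℕ} {g : ℕ → ℝ} (hA : RGEqH K β g) (hbox : ∀ k, k ≤ K → 0 < g k ∧ g k ≤ γ)
    {i : ℕ} (hi : i ≤ K) : b * ((K - i : ℕ) : ℝ) * (g i) ^ 3 ≤ g K / 2 := by
  have hlo : BetaLowerH b γ β :=
    RemainderExplicitHistoryHalfMomentWitness.lower (γ := γ) (lam := fun k i => ρ (k - i)) hβ (fun k i => hρ0 _)
  have h1 := inv_sq_lower_of_betaLower hA hbox hlo hi
  have hu := (hbox i hi).1
  have hv := (hbox K le_rfl).1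
  set u := g i with hu_def
  set v := g K with hv_def
  have h2 : b * ((K - i : ℕ) : ℝ) ≤ 1 / u ^ 2 - 1 / v ^ 2 := by linarith
  have h3 : b * ((K - i : ℕ) : ℝ) * u ^ 3 ≤ (1 / u ^ 2 - 1 / v ^ 2) * u ^ 3 :=
    mul_le_mul_of_nonneg_right h2 (pow_pos hu 3).le
  have h4 : (1 / u ^ 2 - 1 / v ^ 2) * u ^ 3 = (u * v ^ 2 - u ^ 3) / v ^ 2 := by
    field_simp
  have h5 : (u * v ^ 2 - u ^ 3) / v ^ 2 ≤ v / 2 := by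
    rw [div_le_iff₀ (pow_pos hv 2)]
    nlinarith [mul_nonneg hv.le (sq_nonneg (v - 2 * u)), mul_nonneg hu.le (sq_nonneg (v - u))]
  linarith [h3, h4.le, h4.ge, h5]

/-- ULTRAVIOLET SUPPRESSION, SQUARE FORM: `b·(K − i)·(g_i)² ≤ 1` for `i ≤ K`. [cite: Balaban1987RG1, (0.31) p.259] -/
theorem dist_mul_sq_le_one
    (hβ : ∀ (k : ℕ) (p : Fin (k + 1) → ℝ),
      β k p = b + ∑ i : Fin (k + 1), ρ (k - i) * min (p (Fin.last k)) (|p (Fin.last k) - p i|))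
    (hρ0 : ∀ a, 0 ≤ ρ a) {K : ℕ} {g : ℕ → ℝ} (hA : RGEqH K β g) (hbox : ∀ k, k ≤ K → 0 < g k ∧ g k ≤ γ)
    {i : ℕ} (hi : i ≤ K) : b * ((K - i : ℕ) : ℝ) * (g i) ^ 2 ≤ 1 := by
  have hlo : BetaLowerH b γ β :=
    RemainderExplicitHistoryHalfMomentWitness.lower (γ := γ) (lam := fun k i => ρ (k - i)) hβ (fun k i => hρ0 _)
  have h1 := inv_sq_lower_of_betaLower hA hbox hlo hi
  have hu := (hbox i hi).1
  have hK0 : 0 ≤ 1 / (g K) ^ 2 := by positivity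
  have h2 : b * ((K - i : ℕ) : ℝ) ≤ 1 / (g i) ^ 2 := by linarith
  have := mul_le_mul_of_nonneg_right h2 (pow_pos hu 2).le
  rwa [one_div_mul_cancel (pow_pos hu 2).ne'] at this

/-- ON A BOX RUN EVERY β IS AT MOST `b + Wγ`: `β_t(g_0..g_t) = b + Σ_{i≤t} ρ(t−i)(g_t − g_i) ≤ b + W·γ` (`0 ≤ g_t − g_i ≤ g_t ≤ γ`, `Σρ ≤ W`).
[cite: Balaban1987RG1, §5 p.298] -/
theorem beta_run_le
    (hβ : ∀ (k : ℕ) (p : Fin (k + 1) → ℝ),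
      β k p = b + ∑ i : Fin (k + 1), ρ (k - i) * min (p (Fin.last k)) (|p (Fin.last k) - p i|))
    (hb : 0 < b) (hρ0 : ∀ a, 0 ≤ ρ a) (hρW : ∀ n, ∑ a ∈ range n, ρ a ≤ W) {K : ℕ} {g : ℕ → ℝ} (hA : RGEqH K β g)
    (hbox : ∀ k, k ≤ K → 0 < g k ∧ g k ≤ γ) {t : ℕ} (ht : t ≤ K) : β t (prefixOf g t) ≤ b + W * γ := by
  have hpos : ∀ k, k ≤ K → 0 < g k := fun k hk => (hbox k hk).1
  rw [beta_prefix_run_range hβ hb hρ0 hA hpos ht]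
  have hgt := hbox t ht
  have h1 : ∑ i ∈ range (t + 1), ρ (t - i) * (g t - g i) ≤ ∑ i ∈ range (t + 1), ρ (t - i) * γ := by
    refine Finset.sum_le_sum fun i hi => mul_le_mul_of_nonneg_left ?_ (hρ0 _)
    have hi' : i ≤ t := Nat.lt_succ_iff.mp (Finset.mem_range.mp hi)
    linarith [(hbox i (hi'.trans ht)).1, hgt.2]
  have h2 : ∑ i ∈ range (t + 1), ρ (t - i) * γ = γ * ∑ a ∈ range (t + 1), ρ a := by
    rw [← Finset.sum_mul, mul_comm, ← Finset.sum_range_reflect (fun a => ρ a) (t + 1)]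
    exact congrArg (fun s => γ * s) (Finset.sum_congr rfl fun _ _ => rfl)
  have hγ0 : 0 ≤ γ := by linarith [hgt.1, hgt.2]
  have h3 := mul_le_mul_of_nonneg_left (hρW (t + 1)) hγ0
  linarith

/-- THE INCREMENTS OF A BOX RUN: `g_{t+1} − g_t ≤ ((b + Wγ)∕2)·(g_{t+1})³` for `t < K` (`…Weights.gap_le_cube_mul` and `beta_run_le`).
[cite: Balaban1987RG1, (0.20) p.256 and §5 p.298] -/
theorem incr_le
    (hβ : ∀ (k : ℕ) (p : Fin (k + 1) → ℝ),
      β k p = b + ∑ i : Fin (k + 1), ρ (k - i) * min (p (Fin.last k)) (|p (Fin.last k) - p i|))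
    (hb : 0 < b) (hρ0 : ∀ a, 0 ≤ ρ a) (hρW : ∀ n, ∑ a ∈ range n, ρ a ≤ W) {K : ℕ} {g : ℕ → ℝ} (hA : RGEqH K β g)
    (hbox : ∀ k, k ≤ K → 0 < g k ∧ g k ≤ γ) {t : ℕ} (ht : t < K) : g (t + 1) - g t ≤ (b + W * γ) / 2 * (g (t + 1)) ^ 3 := by
  have hpos : ∀ k, k ≤ K → 0 < g k := fun k hk => (hbox k hk).1
  have hle : g t ≤ g (t + 1) := run_mono_orderZero hβ hb hρ0 hA hpos (Nat.le_succ t) ht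
  have h1 := gap_le_cube_mul (hpos t ht.le) hle
  have h2 : 1 / (g t) ^ 2 - 1 / (g (t + 1)) ^ 2 = β t (prefixOf g t) := by rw [hA t ht]; ring
  rw [h2] at h1
  have h3 := beta_run_le hβ hb hρ0 hρW hA hbox ht.le
  have hg3 : 0 ≤ (g (t + 1)) ^ 3 / 2 := by have := hpos (t + 1) ht; positivity
  nlinarith [mul_le_mul_of_nonneg_left h3 hg3]

/-- THE COUPLING GAP OVER A STRETCH IS PRICED BY THE CUBES INSIDE IT: `g_M − g_j ≤ ((b + Wγ)∕2)·Σ_{i∈(j,M]} (g_i)³` for `j ≤ M ≤ K`. [folklore] -/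
theorem gap_le_sum_cube
    (hβ : ∀ (k : ℕ) (p : Fin (k + 1) → ℝ),
      β k p = b + ∑ i : Fin (k + 1), ρ (k - i) * min (p (Fin.last k)) (|p (Fin.last k) - p i|))
    (hb : 0 < b) (hρ0 : ∀ a, 0 ≤ ρ a) (hρW : ∀ n, ∑ a ∈ range n, ρ a ≤ W) {K : ℕ} {g : ℕ → ℝ} (hA : RGEqH K β g)
    (hbox : ∀ k, k ≤ K → 0 < g k ∧ g k ≤ γ) {j M : ℕ} (hjM : j ≤ M) (hM : M ≤ K) :
    g M - g j ≤ (b + W * γ) / 2 * ∑ i ∈ Ico (j + 1) (M + 1), (g i) ^ 3 := by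
  induction M, hjM using Nat.le_induction with
  | base => simp
  | succ M hjM ih =>
    have h1 := ih (by omega)
    have h2 := incr_le hβ hb hρ0 hρW hA hbox (t := M) (by omega)
    rw [Finset.sum_Ico_succ_top (by omega : j + 1 ≤ M + 1), mul_add]
    linarith

/-- THE SPREAD OF THE COUPLINGS AHEAD OF A POSITION, BY DOUBLE COUNTING: for `j ≤ M ≤ K`,
`Σ_{l∈[j,M)} (g_l − g_j) ≤ ((b + Wγ)∕2)·Σ_{i∈(j,M)} (M − i)·(g_i)³` (each cube `(g_i)³` feeds the `M − i` positions `l ≥ i`). [folklore] -/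
theorem spread_le_sum
    (hβ : ∀ (k : ℕ) (p : Fin (k + 1) → ℝ),
      β k p = b + ∑ i : Fin (k + 1), ρ (k - i) * min (p (Fin.last k)) (|p (Fin.last k) - p i|))
    (hb : 0 < b) (hρ0 : ∀ a, 0 ≤ ρ a) (hρW : ∀ n, ∑ a ∈ range n, ρ a ≤ W) {K : ℕ} {g : ℕ → ℝ} (hA : RGEqH K β g)
    (hbox : ∀ k, k ≤ K → 0 < g k ∧ g k ≤ γ) {j M : ℕ} (hjM : j ≤ M) (hM : M ≤ K) :
    ∑ l ∈ Ico j M, (g l - g j) ≤ (b + W * γ) / 2 * ∑ i ∈ Ico (j + 1) (M + 1), ((M : ℝ) - i) * (g i) ^ 3 := by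
  induction M, hjM using Nat.le_induction with
  | base => simp
  | succ M hjM ih =>
    have h1 := ih (by omega)
    have h2 := gap_le_sum_cube hβ hb hρ0 hρW hA hbox hjM (by omega)
    rw [Finset.sum_Ico_succ_top hjM, Finset.sum_Ico_succ_top (by omega : j + 1 ≤ M + 1)]
    have e : ∑ i ∈ Ico (j + 1) (M + 1), (((M + 1 : ℕ) : ℝ) - i) * (g i) ^ 3
        = (∑ i ∈ Ico (j + 1) (M + 1), ((M : ℝ) - i) * (g i) ^ 3) + ∑ i ∈ Ico (j + 1) (M + 1), (g i) ^ 3 := by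
      rw [← Finset.sum_add_distrib]
      exact Finset.sum_congr rfl fun x _ => by push_cast; ring
    have e0 : (((M + 1 : ℕ) : ℝ) - ((M + 1 : ℕ) : ℝ)) * (g (M + 1)) ^ 3 = 0 := by ring
    rw [e, e0, add_zero, mul_add]
    linarith

/-- THE SPREAD AHEAD OF A POSITION IS AT MOST `(1 + Wγ∕b)(K − j − 1)·g_K∕4`: `Σ_{l∈[j,K)} (g_l − g_j) ≤ ((b + Wγ)∕(4b))·(K − j − 1)·g_K`
(`spread_le_sum` + `dist_mul_cube_le_half`). [cite: Balaban1987RG1, (0.31) p.259] -/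
theorem spread_le
    (hβ : ∀ (k : ℕ) (p : Fin (k + 1) → ℝ),
      β k p = b + ∑ i : Fin (k + 1), ρ (k - i) * min (p (Fin.last k)) (|p (Fin.last k) - p i|))
    (hb : 0 < b) (hρ0 : ∀ a, 0 ≤ ρ a) (hρW : ∀ n, ∑ a ∈ range n, ρ a ≤ W) {K : ℕ} {g : ℕ → ℝ} (hA : RGEqH K β g)
    (hbox : ∀ k, k ≤ K → 0 < g k ∧ g k ≤ γ) {j : ℕ} (hj : j ≤ K) :
    ∑ l ∈ Ico j K, (g l - g j) ≤ (b + W * γ) / (4 * b) * (((K - j : ℕ) : ℝ) * g K) := by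
  have hW : 0 ≤ W := by simpa using hρW 0
  have hγ0 : 0 ≤ γ := by linarith [(hbox K le_rfl).1, (hbox K le_rfl).2]
  have hc : 0 ≤ b + W * γ := by nlinarith
  have h1 := spread_le_sum hβ hb hρ0 hρW hA hbox hj le_rfl
  have h2 : ∑ i ∈ Ico (j + 1) (K + 1), ((K : ℝ) - i) * (g i) ^ 3 ≤ ∑ i ∈ Ico (j + 1) (K + 1), g K / (2 * b) := by
    refine Finset.sum_le_sum fun i hi => ?_
    have hi' := Finset.mem_Ico.mp hi
    have hiK : i ≤ K := by omega
    have h := dist_mul_cube_le_half hβ hρ0 hA hbox hiK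
    rw [Nat.cast_sub hiK] at h
    rw [le_div_iff₀ (by positivity)]
    linarith
  rw [Finset.sum_const, Nat.card_Ico, nsmul_eq_mul, show K + 1 - (j + 1) = K - j by omega] at h2
  calc ∑ l ∈ Ico j K, (g l - g j) ≤ (b + W * γ) / 2 * ∑ i ∈ Ico (j + 1) (K + 1), ((K : ℝ) - i) * (g i) ^ 3 := h1
    _ ≤ (b + W * γ) / 2 * (((K - j : ℕ) : ℝ) * (g K / (2 * b))) := mul_le_mul_of_nonneg_left h2 (by positivity)
    _ = (b + W * γ) / (4 * b) * (((K - j : ℕ) : ℝ) * g K) := by field_simp; ring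

/-- THE INCREMENT OVER THE FIRST `j` STEPS CONTROLS THE CUBE: on a box run and `1 ≤ j ≤ K`, `(g_j)³∕2 ≤ (g_j − g_0)·(1∕(j·b) + (g_j)²)` — `1∕g_0² ≥ 1∕g_j² + jb`
gives `g_j − g_0 ≥ (jb∕2)·g_0²g_j`, and `(g_j)³∕2 = g_0²g_j∕2 + (g_j∕2)(g_j + g_0)(g_j − g_0)`. [cite: Balaban1987RG1, (0.20) p.256] -/
theorem cube_le_incr_mul
    (hβ : ∀ (k : ℕ) (p : Fin (k + 1) → ℝ),
      β k p = b + ∑ i : Fin (k + 1), ρ (k - i) * min (p (Fin.last k)) (|p (Fin.last k) - p i|))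
    (hb : 0 < b) (hρ0 : ∀ a, 0 ≤ ρ a) {K : ℕ} {g : ℕ → ℝ} (hA : RGEqH K β g) (hbox : ∀ k, k ≤ K → 0 < g k ∧ g k ≤ γ)
    {j : ℕ} (hj1 : 1 ≤ j) (hj : j ≤ K) : (g j) ^ 3 / 2 ≤ (g j - g 0) * (1 / ((j : ℝ) * b) + (g j) ^ 2) := by
  have hpos : ∀ k, k ≤ K → 0 < g k := fun k hk => (hbox k hk).1
  have hu := hpos 0 (Nat.zero_le _)
  have hv := hpos j hj
  set u := g 0 with hu_def
  set v := g j with hv_def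
  have huv : u ≤ v := run_mono_orderZero hβ hb hρ0 hA hpos (Nat.zero_le j) hj
  -- the telescoped recursion: `1∕u² = 1∕v² + Σ_{t<j} β_t ≥ 1∕v² + j·b`
  have htel := inv_sq_telescopeH hA (Nat.zero_le j) hj
  have hsum : (j : ℝ) * b ≤ ∑ t ∈ Ico 0 j, β t (prefixOf g t) := by
    have : ∑ t ∈ Ico 0 j, β t (prefixOf g t) ≥ ∑ t ∈ Ico 0 j, b :=
      Finset.sum_le_sum fun t ht => beta_pos_of_pos hβ hρ0 fun i => by
        simp only [prefixOf_apply]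
        exact hpos i (by have := i.isLt; have := (Finset.mem_Ico.mp ht).2; omega)
    simpa using this
  have hx : (j : ℝ) * b ≤ 1 / u ^ 2 - 1 / v ^ 2 := by rw [htel]; linarith
  have hj0 : (0 : ℝ) < j := by exact_mod_cast hj1
  -- `j·b·u²·v ≤ 2(v − u)`
  have h1 : (j : ℝ) * b * u ^ 2 * v ≤ 2 * (v - u) := by
    have h := mul_le_mul_of_nonneg_right hx (by positivity : 0 ≤ u ^ 2 * v)
    have e : (1 / u ^ 2 - 1 / v ^ 2) * (u ^ 2 * v) = (v - u) * ((v + u) / v) := by field_simp; ring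
    rw [e] at h
    have hr : (v + u) / v ≤ 2 := by rw [div_le_iff₀ hv]; linarith
    nlinarith [mul_le_mul_of_nonneg_left hr (sub_nonneg.mpr huv)]
  rw [show (g j - g 0) * (1 / ((j : ℝ) * b) + v ^ 2) = (v - u) / ((j : ℝ) * b) + (v - u) * v ^ 2 by ring]
  have h2 : u ^ 2 * v / 2 ≤ (v - u) / ((j : ℝ) * b) := by
    rw [le_div_iff₀ (by positivity)]; nlinarith
  have h3 : v ^ 3 / 2 - u ^ 2 * v / 2 ≤ (v - u) * v ^ 2 := by
    nlinarith [mul_nonneg (sub_nonneg.mpr huv) (mul_nonneg hv.le (sub_nonneg.mpr huv))]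
  linarith

/-- CHEBYSHEV'S SUM INEQUALITY FOR A NON-INCREASING PROFILE AGAINST THE INCREASING SPREAD: on a run with increasing couplings,
`K·Σ_{l∈[j,K)} ρ(l+1)(g_l − g_j) ≤ W·Σ_{l∈[j,K)} (g_l − g_j)` (`ρ` non-increasing on the positive ages, `ρ ≥ 0`, `Σ_{a<N} ρ(a) ≤ W`). [folklore] -/
theorem mul_sum_profile_spread_le (hρ0 : ∀ a, 0 ≤ ρ a) (hρW : ∀ n, ∑ a ∈ range n, ρ a ≤ W)
    (hmono : ∀ a, 1 ≤ a → ρ (a + 1) ≤ ρ a) {K : ℕ} {g : ℕ → ℝ} (hg : ∀ i k, i ≤ k → k ≤ K → g i ≤ g k) {j : ℕ} (hj : j ≤ K) :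
    (K : ℝ) * ∑ l ∈ Ico j K, ρ (l + 1) * (g l - g j) ≤ W * ∑ l ∈ Ico j K, (g l - g j) := by
  classical
  set c : ℕ → ℝ := fun l => max 0 (g l - g j) with hc
  have hcmono : ∀ i k, i ≤ k → k < K → c i ≤ c k := fun i k hik hk =>
    max_le_max le_rfl (by linarith [hg i k hik hk.le])
  have hanti : AntivaryOn (fun l => ρ (l + 1)) c ↑(range K) := by
    intro i hi k hk hlt
    have hi' := Finset.mem_range.mp (Finset.mem_coe.mp hi)
    have hk' := Finset.mem_range.mp (Finset.mem_coe.mp hk)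
    have hik : i < k := by
      by_contra h
      exact absurd (hcmono k i (Nat.le_of_not_lt h) hi') (not_le.mpr hlt)
    exact profile_le_of_le hmono (by omega) (by omega)
  have hcheb := hanti.card_mul_sum_le_sum_mul_sum
  rw [Finset.card_range] at hcheb
  -- identify the sums over `range K` with the sums over `[j, K)`
  have hsplit : ∀ f : ℕ → ℝ, ∑ l ∈ range K, f l = (∑ l ∈ range j, f l) + ∑ l ∈ Ico j K, f l := fun f => by
    rw [Finset.range_eq_Ico, ← Finset.sum_Ico_consecutive f (Nat.zero_le j) hj, Finset.range_eq_Ico]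
  have hzero : ∀ l, l < j → c l = 0 := fun l hl => by
    simp only [hc]; exact max_eq_left (by linarith [hg l j hl.le hj])
  have hpos' : ∀ l, j ≤ l → l < K → c l = g l - g j := fun l hl hlK => by
    simp only [hc]; exact max_eq_right (by linarith [hg j l hl hlK.le])
  have e1 : ∑ l ∈ range K, ρ (l + 1) * c l = ∑ l ∈ Ico j K, ρ (l + 1) * (g l - g j) := by
    rw [hsplit, Finset.sum_eq_zero fun l hl => by rw [hzero l (Finset.mem_range.mp hl), mul_zero], zero_add]
    exact Finset.sum_congr rfl fun l hl => by rw [hpos' l (Finset.mem_Ico.mp hl).1 (Finset.mem_Ico.mp hl).2]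
  have e2 : ∑ l ∈ range K, c l = ∑ l ∈ Ico j K, (g l - g j) := by
    rw [hsplit, Finset.sum_eq_zero fun l hl => hzero l (Finset.mem_range.mp hl), zero_add]
    exact Finset.sum_congr rfl fun l hl => hpos' l (Finset.mem_Ico.mp hl).1 (Finset.mem_Ico.mp hl).2
  rw [e1, e2] at hcheb
  have hρsum : ∑ l ∈ range K, ρ (l + 1) ≤ W := by
    have h := hρW (K + 1)
    rw [Finset.sum_range_succ'] at h
    linarith [hρ0 0]
  have hS0 : 0 ≤ ∑ l ∈ Ico j K, (g l - g j) :=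
    Finset.sum_nonneg fun l hl => by linarith [hg j l (Finset.mem_Ico.mp hl).1 (Finset.mem_Ico.mp hl).2.le]
  exact hcheb.trans (mul_le_mul_of_nonneg_right hρsum hS0)

/-- THE WEIGHTS IN PLAY AT ONE POSITION HAVE TOTAL MASS AT MOST `W`: `Σ_{i<j} ρ(j−i) + ρ(j+1) ≤ W` (the ages `1, …, j` of the common feedback and
the age `j + 1` of B's extra source are distinct; `ρ ≥ 0`, `Σ_{a<N} ρ(a) ≤ W`). [folklore] -/
theorem sum_shift_weights_le (hρ0 : ∀ a, 0 ≤ ρ a) (hρW : ∀ n, ∑ a ∈ range n, ρ a ≤ W) (j : ℕ) :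
    ∑ i ∈ range j, ρ (j - i) + ρ (j + 1) ≤ W := by
  have h1 : ∑ i ∈ range j, ρ (j - i) = ∑ i ∈ range j, ρ (i + 1) := by
    rw [← Finset.sum_range_reflect (fun i => ρ (i + 1)) j]
    refine Finset.sum_congr rfl fun i hi => ?_
    have hi' := Finset.mem_range.mp hi
    congr 1; omega
  have h2 := hρW (j + 2)
  rw [Finset.sum_range_succ, Finset.sum_range_succ'] at h2
  rw [h1]
  linarith [hρ0 0]

/-! ## §2 The denominator of the forward step is at least `13∕24` under `4Wγ ≤ b` -/

/-- THE FEEDBACK COEFFICIENT IS NONNEGATIVE: `0 ≤ Σ_{i<j} ρ(j−i)((g_j)³ − (g_i)³) + ρ(j+1)(g_j)³` on a run (couplings increase). [folklore] -/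
theorem kappa_nonneg
    (hβ : ∀ (k : ℕ) (p : Fin (k + 1) → ℝ),
      β k p = b + ∑ i : Fin (k + 1), ρ (k - i) * min (p (Fin.last k)) (|p (Fin.last k) - p i|))
    (hb : 0 < b) (hρ0 : ∀ a, 0 ≤ ρ a) {K : ℕ} {g : ℕ → ℝ} (hA : RGEqH K β g) (hbox : ∀ k, k ≤ K → 0 < g k ∧ g k ≤ γ)
    {j : ℕ} (hj : j ≤ K) : 0 ≤ (∑ i ∈ range j, ρ (j - i) * ((g j) ^ 3 - (g i) ^ 3)) + ρ (j + 1) * (g j) ^ 3 := by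
  have hpos : ∀ k, k ≤ K → 0 < g k := fun k hk => (hbox k hk).1
  refine add_nonneg (Finset.sum_nonneg fun i hi => mul_nonneg (hρ0 _) ?_) (mul_nonneg (hρ0 _) (pow_pos (hpos j hj) 3).le)
  have hi' := Finset.mem_range.mp hi
  have hle := run_mono_orderZero hβ hb hρ0 hA hpos hi'.le hj
  nlinarith [pow_le_pow_left₀ (hpos i (by omega)).le hle 3]

/-- **THE FIRST SCALAR INEQUALITY, AND `Θ_j ≥ 13∕24`.**  On a box run with `Σ_{a<N} ρ(a) ≤ W` and `4Wγ ≤ b`, for every `j ≤ K`: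
`13∕24 + (K − j)κ₂∕2 ≤ Θ_j = 1 − (K − j)σ₂∕2 − Λ₂∕(2(1 − Wγ∕b))` — since `(K − j)(σ₂ + κ₂)∕2 = (K − j)(g_j)³(Σ_{i<j}ρ(j−i) + ρ(j+1))∕2 ≤ Wγ∕(2b) ≤ 1∕8`
(ultraviolet suppression) and `Λ₂ ≤ W·Σ_{i<K}(g_i)³ ≤ 2Wγ∕b` (asymptotic-freedom budget), `Λ₂∕(2(1 − Wγ∕b)) ≤ (1∕4)∕(3∕4) = 1∕3`.
[cite: Balaban1987RG1, (0.31) p.259] -/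
theorem theta_lower
    (hβ : ∀ (k : ℕ) (p : Fin (k + 1) → ℝ),
      β k p = b + ∑ i : Fin (k + 1), ρ (k - i) * min (p (Fin.last k)) (|p (Fin.last k) - p i|))
    (hb : 0 < b) (hγ : 0 < γ) (hρ0 : ∀ a, 0 ≤ ρ a) (hρW : ∀ n, ∑ a ∈ range n, ρ a ≤ W) (hWγ : 4 * (W * γ) ≤ b) {K : ℕ} {g : ℕ → ℝ}
    (hA : RGEqH K β g) (hbox : ∀ k, k ≤ K → 0 < g k ∧ g k ≤ γ) {j : ℕ} (hj : j ≤ K) :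
    13 / 24 + ((K - j : ℕ) : ℝ) * ((∑ i ∈ range j, ρ (j - i) * ((g j) ^ 3 - (g i) ^ 3)) + ρ (j + 1) * (g j) ^ 3) / 2
      ≤ 1 - ((K - j : ℕ) : ℝ) * (∑ i ∈ range j, ρ (j - i) * (g i) ^ 3) / 2
          - (∑ i ∈ Ico j K, (W - ∑ a ∈ range (i + 1), ρ a) * (g i) ^ 3) / (2 * (1 - W * γ / b)) := by
  have hpos : ∀ k, k ≤ K → 0 < g k := fun k hk => (hbox k hk).1
  have hW : 0 ≤ W := by simpa using hρW 0
  have hlo : BetaLowerH b γ β :=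
    RemainderExplicitHistoryHalfMomentWitness.lower (γ := γ) (lam := fun k i => ρ (k - i)) hβ (fun k i => hρ0 _)
  -- the common feedback and B's extra weight: total mass `≤ W`, one cube, `K − j` positions ahead
  have hsum : (∑ i ∈ range j, ρ (j - i) * (g i) ^ 3) + ((∑ i ∈ range j, ρ (j - i) * ((g j) ^ 3 - (g i) ^ 3))
      + ρ (j + 1) * (g j) ^ 3) = (g j) ^ 3 * (∑ i ∈ range j, ρ (j - i) + ρ (j + 1)) := by
    rw [mul_add, Finset.mul_sum, ← add_assoc, ← Finset.sum_add_distrib]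
    congr 1
    · exact Finset.sum_congr rfl fun i _ => by ring
    · ring
  have hmass := sum_shift_weights_le hρ0 hρW j
  have hcube := cube_mul_dist_le hβ hb hρ0 hA hbox hj
  have hg3 : 0 ≤ (g j) ^ 3 := (pow_pos (hpos j hj) 3).le
  have hKj : 0 ≤ ((K - j : ℕ) : ℝ) := Nat.cast_nonneg _
  have h1 : ((K - j : ℕ) : ℝ) * ((g j) ^ 3 * (∑ i ∈ range j, ρ (j - i) + ρ (j + 1))) ≤ γ / b * W := by
    calc ((K - j : ℕ) : ℝ) * ((g j) ^ 3 * (∑ i ∈ range j, ρ (j - i) + ρ (j + 1)))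
        = ((g j) ^ 3 * ((K - j : ℕ) : ℝ)) * (∑ i ∈ range j, ρ (j - i) + ρ (j + 1)) := by ring
      _ ≤ γ / b * W := mul_le_mul hcube hmass (by
          have : 0 ≤ ∑ i ∈ range j, ρ (j - i) := Finset.sum_nonneg fun i _ => hρ0 _
          linarith [hρ0 (j + 1)]) (by positivity)
  have h1' : γ / b * W ≤ 1 / 4 := by
    rw [div_mul_eq_mul_div, div_le_iff₀ hb]; linarith
  -- the future-in-memory feedback: tail masses `≤ W`, cubes within the asymptotic-freedom budget
  have hΛ : ∑ i ∈ Ico j K, (W - ∑ a ∈ range (i + 1), ρ a) * (g i) ^ 3 ≤ W * (2 * γ / b) := by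
    calc ∑ i ∈ Ico j K, (W - ∑ a ∈ range (i + 1), ρ a) * (g i) ^ 3 ≤ ∑ i ∈ Ico j K, W * (g i) ^ 3 := by
          refine Finset.sum_le_sum fun i hi => mul_le_mul_of_nonneg_right ?_ (pow_pos (hpos i (Finset.mem_Ico.mp hi).2.le) 3).le
          linarith [Finset.sum_nonneg fun a (_ : a ∈ range (i + 1)) => hρ0 a]
      _ ≤ ∑ i ∈ range K, W * (g i) ^ 3 :=
          Finset.sum_le_sum_of_subset_of_nonneg (fun i hi => Finset.mem_range.mpr (Finset.mem_Ico.mp hi).2)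
            fun i hi _ => mul_nonneg hW (pow_pos (hpos i (Finset.mem_range.mp hi).le) 3).le
      _ = W * ∑ i ∈ range K, (g i) ^ 3 := by rw [Finset.mul_sum]
      _ ≤ W * (2 * γ / b) := by
          refine mul_le_mul_of_nonneg_left ?_ hW
          calc ∑ t ∈ range K, (g t) ^ 3 ≤ ∑ t ∈ range K, 1 / (sprof γ b (K - t)) ^ 2 * (1 / sprof γ b (K - t)) :=
                Finset.sum_le_sum fun t ht => cube_le_weight hγ hb hA hbox hlo (Finset.mem_range.mp ht).le
            _ ≤ 2 * γ / b := sum_weights_lt_le hγ hb K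
  have hc : 0 < 1 - W * γ / b := by
    have : W * γ / b ≤ 1 / 4 := by rw [div_le_iff₀ hb]; linarith
    linarith
  have hΛ' : (∑ i ∈ Ico j K, (W - ∑ a ∈ range (i + 1), ρ a) * (g i) ^ 3) / (2 * (1 - W * γ / b)) ≤ 1 / 3 := by
    rw [div_le_iff₀ (by positivity)]
    have : W * (2 * γ / b) = 2 * (W * γ / b) := by ring
    have hw : W * γ / b ≤ 1 / 4 := by rw [div_le_iff₀ hb]; linarith
    nlinarith
  nlinarith [hsum, h1, h1', hΛ', mul_nonneg hKj hg3]

end Summit.QuantumFields.BalabanUV.Beta.RemainderExplicitHistoryDiagonalRunEnvelope
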